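import Summits.ResolutionOfSingularities.ResolutionOfSingularities.Theorems.PurelyInseparableDim4ResConeCInfTranslatedStepPrime
import HarnessLib
import HarnessLib.Audit.Tags

/-!
# Purely inseparable four-folds — the TRANSLATED slot step in σ-dress (weights `(n, n) + 0`, `n + d = p`): the u-row FLAG is carried
# and the ♯-pinning identity, every prime (cell `res-dim4-pi`, K2(p) lane, class (iii) flagless branch, piece ♯1σ of (σ♭))

[OURS · counted 0 · cell `res-dim4-pi` · K2(p) lane holder res-dim4-p-12 g5 (rulings g5-33: (σ♭) = the `1 ↦ n` port of the FLAGLESS♯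
tool-box for the class (iii) rows `σ = (2,2)+0` (`d = 5`) and `(3,3)+0` (`d = 4`) at `p = 7`, res-dim4-typ-1 g6 / res-dim4-p-3 g6); this piece
typed by res-dim4-p-7 g6 by signature.]  Nothing here proves FLAGLESS♯, any TAIL(p, d, 3), K2(7), K2(p), `NoIsolatedTrap p p`, the
Cossart–Jannsen–Saito theorem or resolution of singularities in dimension ≥ 4 / characteristic `p` — NOT proved.  AI kernel work, weaker than
expert review.  Pure exponent algebra of ONE step of OUR frame; kills nothing by itself.

THE PORT.  res-dim4-p-3 g6's FILE ♯1 (`…ResConeCInfTranslatedStepPrime`, p724032) is written for the light pair `r = e_j + e_i` (`d + 1 = p`,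
order `d + 2 = p + 1`).  Its §1–§3 (`coeff_add_single_pointTransform_univ_of_le`, `coeff_translate_line_u`, **`coeff_step_translate_u`**) are
WEIGHT-FREE and are reused here by name.  Only §4/§5 carry the weights, through the exact pair ledger and regime R; in σ-dress
(`r = n·e_j + n·e_i`, `n + d = p`, order `p + n = 2n + d`) the substitution is `2 ↦ n + 1`, `3 ↦ n + 2`, `4 ↦ n + 3` on the slot exponents:
* §1 **`coeff_flag_step_translate_u_sigma`** — under the σ-ledger «`f`-degree `≤ d − 1` ⇒ `j`-exponent `≥ n + 1`» the u-row flag coefficient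
  `x_j^{n+1} x_i^{n+1} x_u^{d−1−c′} x_f^{c′}` (`c′ + 2 ≤ d`; degree `p + n + 1`, one above the order) is carried IDENTICALLY by the slot step in
  the chart of `j` translated by any `β·e_u`: its line `{|δ| = p + n + 1, δ_i = n + 1, δ_f = c′}` has `δ_j + δ_u = n + d − c′`, the ledger gives
  `δ_j ≥ n + 1`, so `δ_u ≤ d − 1 − c′` with equality only at the flag exponent itself.
* §2 **`coeff_sharp_step_translate_u_sigma`** — in σ-regime R («`f`-free monomials have `j`-exponent `≥ n + 2`») the child coefficient at
  `x_j^{n+2} x_i^{n+2} x_u^{d−3}` is `(d − 2)·β·g + g′`, `g = coeff x_j^{n+2} x_i^{n+2} x_u^{d−2}` (the σ-♯-flag), `g′ = coeff x_j^{n+3} x_i^{n+2} x_u^{d−3}`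
  (the cross monomial): the line `{|δ| = p + n + 2, δ_i = n + 2, δ_f = 0}` has exactly the members `δ_u = d − 2` (binomial `C(d−2, d−3) = d − 2`)
  and `δ_u = d − 3`.
`n = 1` recovers ♯1 §4/§5 letter for letter (`d + 1 = p`; ♯1 §4's `[Fact p.Prime]` is not needed and dropped).  No `CharP` / `Fact p.Prime` hypothesis: `p` enters through `step p`, `p ≤ ord` and `n + d = p`; the
cleaning test needs only `p ∤ n + 1` resp. `p ∤ n + 2`, which hold because `2 ≤ n + 1 < n + 2 ≤ p − 2 < p` (`d ≥ 2`, resp. `d ≥ 4`).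
[cite: Hauser2010, §§F–G (chart expressions of a point blowup)] [cite: CossartJannsenSaito2020, Lemma 13.2]
bears_on: LADDER-RESOLUTION:D157-DOOR2 (res-dim4-pi · K2(p) · class (iii) σ = (n,n)+0 · flagless branch ♯1σ).  Supports
stmt-ResolutionOfSingularities-16155 (helper).
-/

set_option linter.dupNamespace false -- mandated namespace of this single-conjunct summit

noncomputable section

namespace Summit.ResolutionOfSingularities.ResolutionOfSingularities.Theorems.PIDim4

namespace ResCone

open MvPolynomial Finset
open Literature.AlgebraicGeometry.Resolution
open Literature.AlgebraicGeometry.Resolution.CentreBlowup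
open Literature.AlgebraicGeometry.Resolution.Hauser2010
open Literature.AlgebraicGeometry.Resolution.HauserPerlega2019

variable {K : Type} [Field K]

section StepSigma

variable [DecidableEq K]
variable {j i u f : Fin 4} (hji : j ≠ i) (hju : j ≠ u) (hjf : j ≠ f) (hiu : i ≠ u) (hif : i ≠ f) (huf : u ≠ f)
include hji hju hjf hiu hif huf

/-! ## 1. The u-row FLAG is carried by every translated slot step (σ-dress) -/

/-- **THE σ-FLAG IS CARRIED, any translation** (`n + d = p`, `2 ≤ d`, `c′ + 2 ≤ d`; no primality needed): under the exact σ-pair ledger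
(«`f`-degree `≤ d − 1` ⇒ `j`-exponent `≥ n + 1`», with `p ≤ ord`) the coefficient of the u-row flag monomial
`x_j^{n+1} x_i^{n+1} x_u^{d−1−c′} x_f^{c′}` of the child of the slot step in the chart of `j` translated by ANY `β·e_u` equals the parent's.
`n = 1`: ♯1's `coeff_flag_step_translate_u`. [OURS] [cite: Hauser2010, §§F–G] -/
theorem coeff_flag_step_translate_u_sigma (p : ℕ) {n d : ℕ} (hσ : n + d = p) (hd2 : 2 ≤ d)
    (s : State K) (hq : ((p : ℕ) : ℕ∞) ≤ ordAlong Finset.univ s.F)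
    (hled : ∀ e ∈ s.F.support, e f ≤ d - 1 → n + 1 ≤ e j) (β : K) {c' : ℕ} (hc' : c' + 2 ≤ d) :
    coeff (Finsupp.single j (n + 1) + Finsupp.single i (n + 1) + Finsupp.single u (d - 1 - c') + Finsupp.single f c')
        (CentreBlowup.step p Finset.univ j (Function.update (0 : Fin 4 → K) u β) s).F =
      coeff (Finsupp.single j (n + 1) + Finsupp.single i (n + 1) + Finsupp.single u (d - 1 - c') + Finsupp.single f c') s.F := by
  classical
  set γ : Fin 4 →₀ ℕ := Finsupp.single i (n + 1) + Finsupp.single u (d - 1 - c') + Finsupp.single f c' with hγdef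
  have hγj : γ j = 0 := by
    rw [hγdef, Finsupp.add_apply, Finsupp.add_apply, Finsupp.single_eq_of_ne hji, Finsupp.single_eq_of_ne hju,
      Finsupp.single_eq_of_ne hjf]; simp
  have hγi : γ i = n + 1 := by
    rw [hγdef, Finsupp.add_apply, Finsupp.add_apply, Finsupp.single_eq_same, Finsupp.single_eq_of_ne hiu,
      Finsupp.single_eq_of_ne hif]; simp
  have hγu : γ u = d - 1 - c' := by
    rw [hγdef, Finsupp.add_apply, Finsupp.add_apply, Finsupp.single_eq_of_ne hiu.symm, Finsupp.single_eq_same,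
      Finsupp.single_eq_of_ne huf, zero_add, add_zero]
  have hγf : γ f = c' := by
    rw [hγdef, Finsupp.add_apply, Finsupp.add_apply, Finsupp.single_eq_of_ne hif.symm, Finsupp.single_eq_of_ne huf.symm,
      Finsupp.single_eq_same]; simp
  have hE : (Finsupp.single j (n + 1) + Finsupp.single i (n + 1) + Finsupp.single u (d - 1 - c') + Finsupp.single f c' :
      Fin 4 →₀ ℕ) = γ + Finsupp.single j (p + n + 1 - p) := by
    rw [hγdef, show p + n + 1 - p = n + 1 by omega]
    simp only [add_comm, add_left_comm]
  have hnp : ¬ IsPthPowerExponent p (γ + Finsupp.single j (p + n + 1 - p)) := by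
    rw [← hE, isPthPowerExponent_iff]
    intro h
    have h2 := h i
    rw [(quad_apply hji hju hjf hiu hif huf (n + 1) (n + 1) (d - 1 - c') c').2.1] at h2
    have := Nat.le_of_dvd (by omega) h2
    omega
  rw [hE, coeff_step_translate_u hji hju hjf hiu hif huf p s hq β (by omega) γ hγj hnp]
  rw [Finset.sum_eq_single (γ + Finsupp.single j (p + n + 1 - p))]
  · rw [Finsupp.add_apply, Finsupp.single_eq_of_ne hju.symm, add_zero, Nat.choose_self, Nat.sub_self, pow_zero,
      Nat.cast_one, one_mul, one_mul]
  · intro δ hδ hne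
    rw [Finset.mem_filter] at hδ
    obtain ⟨hmem, hdeg, hδi, hδf⟩ := hδ
    have hδj : n + 1 ≤ δ j := hled δ hmem (by rw [hδf, hγf]; omega)
    have hdeg' := degree_eq_quad hji hju hjf hiu hif huf δ
    rw [hδi, hδf, hγi, hγf, hdeg] at hdeg'
    -- δ_u ≤ d − 1 − c′, and equality forces δ = the flag exponent
    rcases Nat.lt_or_ge (δ u) (γ u) with hlt | hge
    · rw [Nat.choose_eq_zero_of_lt hlt, Nat.cast_zero, zero_mul, zero_mul]
    · exfalso; apply hne
      rw [hγu] at hge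
      have hδu : δ u = d - 1 - c' := by omega
      have hδj' : δ j = n + 1 := by omega
      rw [eq_sum_single_four hji hju hjf hiu hif huf δ, hδj', hδi, hδu, hδf, hγi, hγf, hE]
  · intro hnot
    by_cases h0 : coeff (γ + Finsupp.single j (p + n + 1 - p)) s.F = 0
    · rw [h0, mul_zero]
    · exfalso
      refine hnot (Finset.mem_filter.mpr ⟨mem_support_iff.mpr h0, ?_, ?_, ?_⟩)
      · rw [← hE, degree_quad]; omega
      · rw [Finsupp.add_apply, Finsupp.single_eq_of_ne hji.symm, add_zero]
      · rw [Finsupp.add_apply, Finsupp.single_eq_of_ne hjf.symm, add_zero]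

/-! ## 2. The ♯-pinning identity of the flagless branch (σ-dress) -/

/-- **σ-♯-PINNING IDENTITY** (`n + d = p`, `4 ≤ d`): if every `f`-free monomial of the parent has `j`-exponent `≥ n + 2` (σ-regime R)
then at the slot step in the chart of `j` translated by `β·e_u`
`coeff (x_j^{n+2} x_i^{n+2} x_u^{d−3}) F′ = (d − 2)·β·coeff (x_j^{n+2} x_i^{n+2} x_u^{d−2}) F + coeff (x_j^{n+3} x_i^{n+2} x_u^{d−3}) F`:
the line `{|δ| = p + n + 2, δ_i = n + 2, δ_f = 0}` has only the members `δ_u = d − 2` (the σ-♯-flag, binomial `C(d−2, d−3) = d − 2`) and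
`δ_u = d − 3` (the cross monomial).  `n = 1`: ♯1's `coeff_sharp_step_translate_u`. [OURS] [cite: Hauser2010, §§F–G]
[cite: CossartJannsenSaito2020, Thm. 3.14] -/
theorem coeff_sharp_step_translate_u_sigma (p : ℕ) {n d : ℕ} (hσ : n + d = p) (hd4 : 4 ≤ d) (s : State K)
    (hq : ((p : ℕ) : ℕ∞) ≤ ordAlong Finset.univ s.F) (hR : ∀ e ∈ s.F.support, e f = 0 → n + 2 ≤ e j) (β : K) :
    coeff (Finsupp.single j (n + 2) + Finsupp.single i (n + 2) + Finsupp.single u (d - 3) + Finsupp.single f 0)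
        (CentreBlowup.step p Finset.univ j (Function.update (0 : Fin 4 → K) u β) s).F =
      ((d - 2 : ℕ) : K) * β *
          coeff (Finsupp.single j (n + 2) + Finsupp.single i (n + 2) + Finsupp.single u (d - 2) + Finsupp.single f 0) s.F +
        coeff (Finsupp.single j (n + 3) + Finsupp.single i (n + 2) + Finsupp.single u (d - 3) + Finsupp.single f 0) s.F := by
  classical
  set γ : Fin 4 →₀ ℕ := Finsupp.single i (n + 2) + Finsupp.single u (d - 3) + Finsupp.single f 0 with hγdef
  have hγj : γ j = 0 := by
    rw [hγdef, Finsupp.add_apply, Finsupp.add_apply, Finsupp.single_eq_of_ne hji, Finsupp.single_eq_of_ne hju,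
      Finsupp.single_eq_of_ne hjf]; simp
  have hγi : γ i = n + 2 := by
    rw [hγdef, Finsupp.add_apply, Finsupp.add_apply, Finsupp.single_eq_same, Finsupp.single_eq_of_ne hiu,
      Finsupp.single_eq_of_ne hif]; simp
  have hγu : γ u = d - 3 := by
    rw [hγdef, Finsupp.add_apply, Finsupp.add_apply, Finsupp.single_eq_of_ne hiu.symm, Finsupp.single_eq_same,
      Finsupp.single_eq_of_ne huf, zero_add, add_zero]
  have hγf : γ f = 0 := by
    rw [hγdef, Finsupp.add_apply, Finsupp.add_apply, Finsupp.single_eq_of_ne hif.symm, Finsupp.single_eq_of_ne huf.symm,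
      Finsupp.single_eq_same]; simp
  have hE : (Finsupp.single j (n + 2) + Finsupp.single i (n + 2) + Finsupp.single u (d - 3) + Finsupp.single f 0 : Fin 4 →₀ ℕ) =
      γ + Finsupp.single j (p + n + 2 - p) := by
    rw [hγdef, show p + n + 2 - p = n + 2 by omega]
    simp only [add_comm, add_left_comm]
  -- the two line members
  set E₁ : Fin 4 →₀ ℕ := Finsupp.single j (n + 2) + Finsupp.single i (n + 2) + Finsupp.single u (d - 2) + Finsupp.single f 0
    with hE₁
  set E₂ : Fin 4 →₀ ℕ := Finsupp.single j (n + 3) + Finsupp.single i (n + 2) + Finsupp.single u (d - 3) + Finsupp.single f 0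
    with hE₂
  obtain ⟨h1j, h1i, h1u, h1f⟩ := quad_apply hji hju hjf hiu hif huf (n + 2) (n + 2) (d - 2) 0
  obtain ⟨h2j, h2i, h2u, h2f⟩ := quad_apply hji hju hjf hiu hif huf (n + 3) (n + 2) (d - 3) 0
  have hnp : ¬ IsPthPowerExponent p (γ + Finsupp.single j (p + n + 2 - p)) := by
    rw [← hE, isPthPowerExponent_iff]
    intro h
    have h3 := h i
    rw [(quad_apply hji hju hjf hiu hif huf (n + 2) (n + 2) (d - 3) 0).2.1] at h3
    have := Nat.le_of_dvd (by omega) h3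
    omega
  rw [hE, coeff_step_translate_u hji hju hjf hiu hif huf p s hq β (by omega) γ hγj hnp]
  have hne : E₁ ≠ E₂ := fun h => by
    have hj' : E₁ j = E₂ j := by rw [h]
    rw [h1j, h2j] at hj'
    omega
  rw [Finset.sum_eq_add E₁ E₂ hne]
  · rw [h1u, h2u, hγu, show d - 2 - (d - 3) = 1 by omega, show d - 2 = d - 3 + 1 by omega, Nat.choose_succ_self_right,
      show d - 3 + 1 = d - 2 by omega, Nat.choose_self, Nat.sub_self, pow_one, pow_zero, Nat.cast_one, one_mul, one_mul]
  · intro δ hδ hδne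
    rw [Finset.mem_filter] at hδ
    obtain ⟨hmem, hdeg, hδi, hδf⟩ := hδ
    rw [hγi] at hδi
    rw [hγf] at hδf
    have hδj : n + 2 ≤ δ j := hR δ hmem hδf
    have hdeg' := degree_eq_quad hji hju hjf hiu hif huf δ
    rw [hδi, hδf, hdeg] at hdeg'
    rcases Nat.lt_or_ge (δ u) (γ u) with hlt | hge
    · rw [Nat.choose_eq_zero_of_lt hlt, Nat.cast_zero, zero_mul, zero_mul]
    · exfalso
      rw [hγu] at hge
      have hsplit : (δ j = n + 2 ∧ δ u = d - 2) ∨ (δ j = n + 3 ∧ δ u = d - 3) := by omega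
      rcases hsplit with ⟨hj', hu'⟩ | ⟨hj', hu'⟩
      · apply hδne.1
        rw [eq_sum_single_four hji hju hjf hiu hif huf δ, hj', hδi, hu', hδf]
      · apply hδne.2
        rw [eq_sum_single_four hji hju hjf hiu hif huf δ, hj', hδi, hu', hδf]
  · intro hnot
    by_cases h0 : coeff E₁ s.F = 0
    · rw [h0, mul_zero]
    · exfalso
      exact hnot (Finset.mem_filter.mpr
        ⟨mem_support_iff.mpr h0, by rw [hE₁, degree_quad]; omega, by rw [h1i, hγi], by rw [h1f, hγf]⟩)
  · intro hnot
    by_cases h0 : coeff E₂ s.F = 0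
    · rw [h0, mul_zero]
    · exfalso
      exact hnot (Finset.mem_filter.mpr
        ⟨mem_support_iff.mpr h0, by rw [hE₂, degree_quad]; omega, by rw [h2i, hγi], by rw [h2f, hγf]⟩)

end StepSigma

end ResCone

end Summit.ResolutionOfSingularities.ResolutionOfSingularities.Theorems.PIDim4

end
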